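import Summits.AtomisticToContinuum.Crystallization.Theorems.FrustratedLawDichotomyCellArithLJ

/-!
# FrustratedLawDichotomy · crux `AperiodicFrustratedLawGap` (stmt-AtomisticToContinuum-27623) — CELL-ARITH, the Taylor and far
# columns read in `ℤ`, and signed four-corner products (decomp-a2c hand-1 g53; sequel of `…CellArithLJ`; interface of record r1772 (B))

* §3 ★ `forceRemHiZ`, ★ `energyRemHiZ` — upper readings of (238) `forceRem_le_window` / `energyRem_le_window`'s right-hand sides
  (`le_forceRemHiZ_expr`, `le_energyRemHiZ_expr` = «S·erbW rlo rhi η ≤ X» at rational `rlo rhi η`; the small polynomial factors stay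
  exact in `ℚ`, only `((rlo−η)²)⁻¹^k` and the `|ψ′|`, `|φ″|` windows are read in `ℤ`), the composed `le_forceRemHiZ`/`le_energyRemHiZ`
  (`S·forceRem r η ≤ …` for `η < rlo ≤ r ≤ rhi`), and ★ `debHiZ` = the (251) `hdeb` entry `τ²·secondNeg + energyRem`
  (`le_debHiZ_expr` = «S·(τ²·snbW + erbW) ≤ X», `le_debHiZ`);
* §4 `farColQ`/`tailColQ` — the far columns of (226) as exact rational functions (`farCol_cast`, `farCol_le_farColQ` via (238)
  `farCol_anti`, `mul_farCol_le` = the (251) `hfc` entry from norm witnesses, `tailCol_le_tailColQ` = `htc`, plus their `⌈S·⌉` readings);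
* §5 signed FOUR-CORNER readings `cornerLo/cornerHi` (reading-interval × exact-rational-interval) — the pairing terms `ψ(t)·g` of the
  host-force column ((252) `inner_posL_sum_ljBondForce`) and the coordinates of the NASH residual ((252) `nashVecLab`, multipliers in
  the label frame per lens-5 AMEND l.9363).

Plain computable `def`s (`ℤ`/`ℚ`), no instance / notation / option; imports `…CellArithLJ`; 0 sorry.  Tags: [folklore].
-/

namespace Summit.AtomisticToContinuum.Crystallization.Theorems.FrustratedLawDichotomyCellArithTaylor

open Summit.AtomisticToContinuum.Crystallization.Theorems.FrustratedLawDichotomyCoherentFloorAlgebra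
  (phiT1 phiT2 psiT psiT1 forceRem energyRem secondNeg)
open Summit.AtomisticToContinuum.Crystallization.Theorems.FrustratedLawDichotomyCoherentFloor (farCol tailCol)
open Summit.AtomisticToContinuum.Crystallization.Theorems.FrustratedLawDichotomyCellEnclosures
  (forceRem_le_window energyRem_le_window farCol_anti tailCol_anti mul_le_of_corners corners_le_mul)
open Summit.AtomisticToContinuum.Crystallization.Theorems.FrustratedLawDichotomyCellArith
open Summit.AtomisticToContinuum.Crystallization.Theorems.FrustratedLawDichotomyCellArithLJ

/-! ## §3 The Taylor columns `forceRem`, `energyRem` on an `r`-window, and the debit entry -/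

/-- upper reading of (238) `forceRem_le_window`'s right-hand side on `[rlo, rhi]` with displacement size `η` (exact). [folklore] -/
def forceRemHiZ (S : ℤ) (rlo rhi η : ℚ) : ℤ :=
  scHi ((2 * rhi * η + η ^ 2) ^ 2 * (rhi + η))
      (max (10 * ipHi S ((rlo - η) ^ 2) 6) (28 * ipHi S ((rlo - η) ^ 2) 9))
    + scHi (η ^ 2 * rhi + (2 * rhi * η + η ^ 2) * η) (absPsi1HiZ S (rlo ^ 2) (rhi ^ 2))

/-- upper reading of (238) `energyRem_le_window`'s right-hand side. [folklore] -/
def energyRemHiZ (S : ℤ) (rlo rhi η : ℚ) : ℤ :=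
  scHi ((2 * rhi * η + η ^ 2) ^ 3)
      (max (scHi (14 / 3) (ipHi S ((rlo - η) ^ 2) 9)) (scHi (5 / 3) (ipHi S ((rlo - η) ^ 2) 6)))
    + scHi (2 * rhi * η ^ 3 + 1 / 2 * η ^ 4) (absPhi2HiZ S (rlo ^ 2) (rhi ^ 2))

/-- ★ the (251) `hdeb` entry read in `ℤ`: `τ²·secondNeg + energyRem` from the `r²`-window `[lo, hi]` and an `r`-window
`[rlo, rhi]` of the same site (`rlo² ≤ lo`, `hi ≤ rhi²` is the K-file's sqrt witness, not needed for soundness). [folklore] -/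
def debHiZ (S : ℤ) (lo hi rlo rhi τ : ℚ) : ℤ := scHi (τ ^ 2) (secondNegHiZ S lo hi) + energyRemHiZ S rlo rhi τ

section Taylor

variable {S : ℤ} {rlo rhi η : ℚ} {r : ℝ}

/-- positivity facts of an `r`-window `0 ≤ η < rlo ≤ rhi`. -/
theorem window_pos' (hη : 0 ≤ η) (hlo : η < rlo) (hle : rlo ≤ rhi) :
    0 < (rlo - η) ^ 2 ∧ 0 < rlo ^ 2 ∧ 0 < rhi ^ 2 ∧ 0 < rhi := by
  have hr : 0 < rlo := lt_of_le_of_lt hη hlo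
  have hrhi : 0 < rhi := lt_of_lt_of_le hr hle
  exact ⟨by nlinarith, pow_pos hr 2, pow_pos hrhi 2, hrhi⟩

/-- `rlo ≤ r ≤ rhi` over `ℝ` gives `rlo ≤ rhi` in `ℚ`. -/
theorem le_of_window (h1 : (rlo : ℝ) ≤ r) (h2 : r ≤ (rhi : ℝ)) : rlo ≤ rhi := by
  have : (rlo : ℝ) ≤ rhi := h1.trans h2
  exact_mod_cast this

/-- ★ upper reading of the BOOKED EXPRESSION ((238) `forceRem_le_window`'s right-hand side) at rational `rlo rhi η`,
`0 ≤ η < rlo ≤ rhi`. [folklore] -/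
theorem le_forceRemHiZ_expr (hS : 0 < S) (hη : 0 ≤ η) (hlo : η < rlo) (hle : rlo ≤ rhi) :
    S * (max (10 * ((((rlo : ℝ) - η) ^ 2)⁻¹ ^ 6)) (28 * ((((rlo : ℝ) - η) ^ 2)⁻¹ ^ 9))
          * (2 * (rhi : ℝ) * η + (η : ℝ) ^ 2) ^ 2 * (rhi + η)
        + max (-(-4 * ((rlo : ℝ) ^ 2)⁻¹ ^ 5 + 7 * ((rhi : ℝ) ^ 2)⁻¹ ^ 8))
            (-4 * ((rhi : ℝ) ^ 2)⁻¹ ^ 5 + 7 * ((rlo : ℝ) ^ 2)⁻¹ ^ 8)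
          * ((η : ℝ) ^ 2 * rhi + (2 * rhi * η + (η : ℝ) ^ 2) * η))
      ≤ ((forceRemHiZ S rlo rhi η : ℤ) : ℝ) := by
  obtain ⟨hρ, hl2, hh2, hrhi⟩ := window_pos' hη hlo hle
  have P6 := le_ipHi hS hρ 6; have P9 := le_ipHi hS hρ 9
  have P6' : (S : ℝ) * (10 * (((rlo : ℝ) - η) ^ 2)⁻¹ ^ 6) ≤ ((10 * ipHi S ((rlo - η) ^ 2) 6 : ℤ) : ℝ) := by
    push_cast at P6 ⊢; linarith
  have P9' : (S : ℝ) * (28 * (((rlo : ℝ) - η) ^ 2)⁻¹ ^ 9) ≤ ((28 * ipHi S ((rlo - η) ^ 2) 9 : ℤ) : ℝ) := by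
    push_cast at P9 ⊢; linarith
  have M := max_le_max_readings P6' P9' hS.le
  have hA0 : 0 ≤ (2 * rhi * η + η ^ 2) ^ 2 * (rhi + η) := by positivity
  have T1 := le_scHi hA0 M
  have Ψ := le_absPsi1HiZ_expr hS hl2 hh2
  have hC0 : 0 ≤ η ^ 2 * rhi + (2 * rhi * η + η ^ 2) * η := by positivity
  have T2 := le_scHi hC0 Ψ
  unfold forceRemHiZ
  push_cast at T1 T2 ⊢
  have e1 : (S : ℝ) * (max (10 * (((rlo : ℝ) - η) ^ 2)⁻¹ ^ 6) (28 * (((rlo : ℝ) - η) ^ 2)⁻¹ ^ 9)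
      * (2 * (rhi : ℝ) * η + (η : ℝ) ^ 2) ^ 2 * (rhi + η))
      = S * (((2 * (rhi : ℝ) * η + (η : ℝ) ^ 2) ^ 2 * (rhi + η))
        * max (10 * (((rlo : ℝ) - η) ^ 2)⁻¹ ^ 6) (28 * (((rlo : ℝ) - η) ^ 2)⁻¹ ^ 9)) := by ring
  have e2 : (S : ℝ) * (max (-(-4 * ((rlo : ℝ) ^ 2)⁻¹ ^ 5 + 7 * ((rhi : ℝ) ^ 2)⁻¹ ^ 8))
        (-4 * ((rhi : ℝ) ^ 2)⁻¹ ^ 5 + 7 * ((rlo : ℝ) ^ 2)⁻¹ ^ 8)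
      * ((η : ℝ) ^ 2 * rhi + (2 * rhi * η + (η : ℝ) ^ 2) * η))
      = S * (((η : ℝ) ^ 2 * rhi + (2 * rhi * η + (η : ℝ) ^ 2) * η)
        * max (-(-4 * ((rlo : ℝ) ^ 2)⁻¹ ^ 5 + 7 * ((rhi : ℝ) ^ 2)⁻¹ ^ 8))
          (-4 * ((rhi : ℝ) ^ 2)⁻¹ ^ 5 + 7 * ((rlo : ℝ) ^ 2)⁻¹ ^ 8)) := by ring
  rw [mul_add, e1, e2]
  linarith

/-- ★ `S·forceRem r η ≤ forceRemHiZ S rlo rhi η` for `0 ≤ η < rlo ≤ r ≤ rhi` ((238) `forceRem_le_window` ∘ `_expr`). [folklore] -/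
theorem le_forceRemHiZ (hS : 0 < S) (hη : 0 ≤ η) (hlo : η < rlo) (h1 : (rlo : ℝ) ≤ r) (h2 : r ≤ (rhi : ℝ)) :
    S * forceRem r η ≤ ((forceRemHiZ S rlo rhi η : ℤ) : ℝ) := by
  have hS' : (0 : ℝ) < S := by exact_mod_cast hS
  have W := forceRem_le_window (r := r) (by exact_mod_cast hη : (0 : ℝ) ≤ η)
    (by exact_mod_cast hlo : (η : ℝ) < rlo) h1 h2
  exact (mul_le_mul_of_nonneg_left W hS'.le).trans (le_forceRemHiZ_expr hS hη hlo (le_of_window h1 h2))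

/-- ★ upper reading of the BOOKED EXPRESSION ((238) `energyRem_le_window`'s right-hand side = (261)'s `erbW rlo rhi η`) at
rational `rlo rhi η`, `0 ≤ η < rlo ≤ rhi`. [folklore] -/
theorem le_energyRemHiZ_expr (hS : 0 < S) (hη : 0 ≤ η) (hlo : η < rlo) (hle : rlo ≤ rhi) :
    S * (max (14 / 3 * ((((rlo : ℝ) - η) ^ 2)⁻¹ ^ 9)) (5 / 3 * ((((rlo : ℝ) - η) ^ 2)⁻¹ ^ 6))
          * (2 * (rhi : ℝ) * η + (η : ℝ) ^ 2) ^ 3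
        + max (-(7 / 2 * ((rhi : ℝ) ^ 2)⁻¹ ^ 8 - 2 * ((rlo : ℝ) ^ 2)⁻¹ ^ 5))
            (7 / 2 * ((rlo : ℝ) ^ 2)⁻¹ ^ 8 - 2 * ((rhi : ℝ) ^ 2)⁻¹ ^ 5)
          * (2 * (rhi : ℝ) * (η : ℝ) ^ 3 + 1 / 2 * (η : ℝ) ^ 4))
      ≤ ((energyRemHiZ S rlo rhi η : ℤ) : ℝ) := by
  obtain ⟨hρ, hl2, hh2, hrhi⟩ := window_pos' hη hlo hle
  have P9 := le_scHi (c := 14 / 3) (by norm_num) (le_ipHi hS hρ 9)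
  have P6 := le_scHi (c := 5 / 3) (by norm_num) (le_ipHi hS hρ 6)
  have M := max_le_max_readings P9 P6 hS.le
  have hA0 : 0 ≤ (2 * rhi * η + η ^ 2) ^ 3 := by positivity
  have T1 := le_scHi hA0 M
  have Φ := le_absPhi2HiZ_expr hS hl2 hh2
  have hD0 : 0 ≤ 2 * rhi * η ^ 3 + 1 / 2 * η ^ 4 := by positivity
  have T2 := le_scHi hD0 Φ
  unfold energyRemHiZ
  push_cast at T1 T2 ⊢
  have e1 : (S : ℝ) * (max (14 / 3 * (((rlo : ℝ) - η) ^ 2)⁻¹ ^ 9) (5 / 3 * (((rlo : ℝ) - η) ^ 2)⁻¹ ^ 6)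
      * (2 * (rhi : ℝ) * η + (η : ℝ) ^ 2) ^ 3)
      = S * ((2 * (rhi : ℝ) * η + (η : ℝ) ^ 2) ^ 3
        * max (14 / 3 * (((rlo : ℝ) - η) ^ 2)⁻¹ ^ 9) (5 / 3 * (((rlo : ℝ) - η) ^ 2)⁻¹ ^ 6)) := by ring
  have e2 : (S : ℝ) * (max (-(7 / 2 * ((rhi : ℝ) ^ 2)⁻¹ ^ 8 - 2 * ((rlo : ℝ) ^ 2)⁻¹ ^ 5))
        (7 / 2 * ((rlo : ℝ) ^ 2)⁻¹ ^ 8 - 2 * ((rhi : ℝ) ^ 2)⁻¹ ^ 5)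
      * (2 * (rhi : ℝ) * (η : ℝ) ^ 3 + 1 / 2 * (η : ℝ) ^ 4))
      = S * ((2 * (rhi : ℝ) * (η : ℝ) ^ 3 + 1 / 2 * (η : ℝ) ^ 4)
        * max (-(7 / 2 * ((rhi : ℝ) ^ 2)⁻¹ ^ 8 - 2 * ((rlo : ℝ) ^ 2)⁻¹ ^ 5))
          (7 / 2 * ((rlo : ℝ) ^ 2)⁻¹ ^ 8 - 2 * ((rhi : ℝ) ^ 2)⁻¹ ^ 5)) := by ring
  rw [mul_add, e1, e2]
  linarith

/-- ★ `S·energyRem r η ≤ energyRemHiZ S rlo rhi η` for `0 ≤ η < rlo ≤ r ≤ rhi` ((238) `energyRem_le_window` ∘ `_expr`). [folklore] -/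
theorem le_energyRemHiZ (hS : 0 < S) (hη : 0 ≤ η) (hlo : η < rlo) (h1 : (rlo : ℝ) ≤ r) (h2 : r ≤ (rhi : ℝ)) :
    S * energyRem r η ≤ ((energyRemHiZ S rlo rhi η : ℤ) : ℝ) := by
  have hS' : (0 : ℝ) < S := by exact_mod_cast hS
  have W := energyRem_le_window (r := r) (by exact_mod_cast hη : (0 : ℝ) ≤ η)
    (by exact_mod_cast hlo : (η : ℝ) < rlo) h1 h2
  exact (mul_le_mul_of_nonneg_left W hS'.le).trans (le_energyRemHiZ_expr hS hη hlo (le_of_window h1 h2))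

/-- ★ upper reading of (261)'s booked debit `τ²·snbW lo hi + erbW rlo rhi τ` (as its verbatim expression) at rational data. [folklore] -/
theorem le_debHiZ_expr {lo hi τ : ℚ} (hS : 0 < S) (h0 : 0 < lo) (hh : 0 < hi) (hτ : 0 ≤ τ) (hlo : τ < rlo)
    (hle : rlo ≤ rhi) :
    S * ((τ : ℝ) ^ 2 * max 0 (-(-(1 / 2) * (lo : ℝ)⁻¹ ^ 7 + 1 / 2 * (hi : ℝ)⁻¹ ^ 4)
          + 2 * (hi : ℝ) * max 0 (-(7 / 2 * (hi : ℝ)⁻¹ ^ 8 - 2 * (lo : ℝ)⁻¹ ^ 5)))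
        + (max (14 / 3 * ((((rlo : ℝ) - τ) ^ 2)⁻¹ ^ 9)) (5 / 3 * ((((rlo : ℝ) - τ) ^ 2)⁻¹ ^ 6))
            * (2 * (rhi : ℝ) * τ + (τ : ℝ) ^ 2) ^ 3
          + max (-(7 / 2 * ((rhi : ℝ) ^ 2)⁻¹ ^ 8 - 2 * ((rlo : ℝ) ^ 2)⁻¹ ^ 5))
              (7 / 2 * ((rlo : ℝ) ^ 2)⁻¹ ^ 8 - 2 * ((rhi : ℝ) ^ 2)⁻¹ ^ 5)
            * (2 * (rhi : ℝ) * (τ : ℝ) ^ 3 + 1 / 2 * (τ : ℝ) ^ 4)))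
      ≤ ((debHiZ S lo hi rlo rhi τ : ℤ) : ℝ) := by
  have A := le_scHi (c := τ ^ 2) (by positivity) (le_secondNegHiZ_expr hS h0 hh)
  have B := le_energyRemHiZ_expr hS hτ hlo hle
  unfold debHiZ; push_cast at A B ⊢
  rw [mul_add]; exact add_le_add A B

/-- ★ THE (251) `hdeb` ENTRY: `lo ≤ ‖x‖² ≤ hi`, `rlo ≤ ‖x‖ ≤ rhi`, `0 ≤ τ < rlo ⇒ S·(τ²·secondNeg ‖x‖ + energyRem ‖x‖ τ) ≤ debHiZ`. [folklore] -/
theorem le_debHiZ {lo hi τ : ℚ} (hS : 0 < S) (h0 : 0 < lo) (h1 : (lo : ℝ) ≤ r ^ 2) (h2 : r ^ 2 ≤ (hi : ℝ))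
    (hτ : 0 ≤ τ) (hlo : τ < rlo) (h3 : (rlo : ℝ) ≤ r) (h4 : r ≤ (rhi : ℝ)) :
    S * ((τ : ℝ) ^ 2 * secondNeg r + energyRem r τ) ≤ ((debHiZ S lo hi rlo rhi τ : ℤ) : ℝ) := by
  have A := le_scHi (c := τ ^ 2) (by positivity) (le_secondNegHiZ hS h0 h1 h2)
  have B := le_energyRemHiZ hS hτ hlo h3 h4
  unfold debHiZ; push_cast at A B ⊢
  rw [mul_add]; exact add_le_add A B

end Taylor

/-! ## §4 The far columns as exact rational functions -/

/-- (226) `farCol` over `ℚ` (same literal). [folklore] -/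
def farColQ (R : ℚ) : ℚ :=
  6000 / 343 * R⁻¹ ^ 4 + 2880 / 49 * R⁻¹ ^ 5 + 10 / 7 * R⁻¹ ^ 6 + 2 * R⁻¹ ^ 7 +
    (2400 / 343 * R⁻¹ ^ 10 + 28800 / 539 * R⁻¹ ^ 11 + 5 / 7 * R⁻¹ ^ 12 + 2 * R⁻¹ ^ 13)

/-- (226) `tailCol` over `ℚ` (same literal). [folklore] -/
def tailColQ (R : ℚ) : ℚ := 4000 / 1029 * R⁻¹ ^ 3 + 500 / 49 * R⁻¹ ^ 4 + 2 / 7 * R⁻¹ ^ 5 + 1 / 3 * R⁻¹ ^ 6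

/-- `farCol` at a rational point is the cast of `farColQ`. [folklore] -/
theorem farCol_cast (R : ℚ) : farCol (R : ℝ) = ((farColQ R : ℚ) : ℝ) := by
  unfold farCol farColQ; push_cast; ring

/-- `tailCol` at a rational point is the cast of `tailColQ`. [folklore] -/
theorem tailCol_cast (R : ℚ) : tailCol (R : ℝ) = ((tailColQ R : ℚ) : ℝ) := by
  unfold tailCol tailColQ; push_cast; ring

/-- `farCol` is nonnegative on `[0, ∞)`. [folklore] -/
theorem farCol_nonneg {R : ℝ} (h : 0 ≤ R) : 0 ≤ farCol R := by
  unfold farCol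
  have : 0 ≤ R⁻¹ := inv_nonneg.2 h
  positivity

/-- ★ `0 < R₀ ≤ R ⇒ farCol R ≤ farColQ R₀` ((238) `farCol_anti` + cast). [folklore] -/
theorem farCol_le_farColQ {R₀ : ℚ} {R : ℝ} (h0 : 0 < R₀) (h : (R₀ : ℝ) ≤ R) : farCol R ≤ ((farColQ R₀ : ℚ) : ℝ) := by
  rw [← farCol_cast]; exact farCol_anti (by exact_mod_cast h0) h

/-- ★ `0 < R₀ ≤ R ⇒ tailCol R ≤ tailColQ R₀` — the (251) `htc` entry at any `Rc ≥ R₀`. [folklore] -/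
theorem tailCol_le_tailColQ {R₀ : ℚ} {R : ℝ} (h0 : 0 < R₀) (h : (R₀ : ℝ) ≤ R) : tailCol R ≤ ((tailColQ R₀ : ℚ) : ℝ) := by
  rw [← tailCol_cast]; exact tailCol_anti (by exact_mod_cast h0) h

/-- ★ «S·farCol R ≤ X»: the reading `rdHi S (farColQ R₀)` for any `R ≥ R₀ > 0`. [folklore] -/
theorem le_farColHiZ {S : ℤ} {R₀ : ℚ} {R : ℝ} (hS : 0 ≤ S) (h0 : 0 < R₀) (h : (R₀ : ℝ) ≤ R) :
    S * farCol R ≤ ((rdHi S (farColQ R₀) : ℤ) : ℝ) :=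
  (mul_le_mul_of_nonneg_left (farCol_le_farColQ h0 h) (by exact_mod_cast hS)).trans (le_rdHi S (farColQ R₀))

/-- ★ «S·tailCol Rc ≤ X»: the reading `rdHi S (tailColQ R₀)` for any `Rc ≥ R₀ > 0` (the (251) `htc` number). [folklore] -/
theorem le_tailColHiZ {S : ℤ} {R₀ : ℚ} {R : ℝ} (hS : 0 ≤ S) (h0 : 0 < R₀) (h : (R₀ : ℝ) ≤ R) :
    S * tailCol R ≤ ((rdHi S (tailColQ R₀) : ℤ) : ℝ) :=
  (mul_le_mul_of_nonneg_left (tailCol_le_tailColQ h0 h) (by exact_mod_cast hS)).trans (le_rdHi S (tailColQ R₀))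

/-- ★ THE (251) `hfc` ENTRY from witnesses: `0 ≤ a ≤ yb` (the multiplier norm), `b ≤ ρ` (the site norm), `0 < Rc − (ρ + τ)` ⇒
`a·farCol (Rc − (b + τ)) ≤ yb·farColQ (Rc − (ρ + τ))` (all bounds exact rationals). [folklore] -/
theorem mul_farCol_le {a b : ℝ} {yb ρ τ Rc : ℚ} (ha0 : 0 ≤ a) (ha : a ≤ (yb : ℝ)) (hb : b ≤ (ρ : ℝ))
    (hpos : 0 < Rc - (ρ + τ)) :
    a * farCol ((Rc : ℝ) - (b + (τ : ℝ))) ≤ ((yb * farColQ (Rc - (ρ + τ)) : ℚ) : ℝ) := by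
  have hpos' : (0 : ℝ) < (Rc : ℝ) - ((ρ : ℝ) + τ) := by exact_mod_cast hpos
  have hle : ((Rc - (ρ + τ) : ℚ) : ℝ) ≤ (Rc : ℝ) - (b + (τ : ℝ)) := by push_cast; linarith
  have h1 := farCol_le_farColQ hpos hle
  have h2 : 0 ≤ farCol ((Rc : ℝ) - (b + (τ : ℝ))) := farCol_nonneg (by push_cast at hle; linarith)
  have hyb : (0 : ℝ) ≤ yb := ha0.trans ha
  push_cast
  calc a * farCol ((Rc : ℝ) - (b + (τ : ℝ))) ≤ (yb : ℝ) * farCol ((Rc : ℝ) - (b + (τ : ℝ))) :=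
        mul_le_mul_of_nonneg_right ha h2
    _ ≤ (yb : ℝ) * ((farColQ (Rc - (ρ + τ)) : ℚ) : ℝ) := mul_le_mul_of_nonneg_left h1 hyb

/-! ## §5 Signed four-corner readings (reading-interval × exact-rational-interval) -/

/-- lower reading of a product `x·g` from a reading interval `PL ≤ S·x ≤ PH` and an exact interval `glo ≤ g ≤ ghi`
(four corners in the order of (238) `corners_le_mul`, rounded down). [folklore] -/
def cornerLo (PL PH : ℤ) (glo ghi : ℚ) : ℤ :=
  min (min ⌊glo * (PL : ℚ)⌋ ⌊glo * (PH : ℚ)⌋) (min ⌊ghi * (PL : ℚ)⌋ ⌊ghi * (PH : ℚ)⌋)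

/-- upper reading of a product `x·g` from a reading interval and an exact interval (four corners, rounded up). [folklore] -/
def cornerHi (PL PH : ℤ) (glo ghi : ℚ) : ℤ :=
  max (max ⌈glo * (PL : ℚ)⌉ ⌈glo * (PH : ℚ)⌉) (max ⌈ghi * (PL : ℚ)⌉ ⌈ghi * (PH : ℚ)⌉)

/-- a ceiling corner: `c·P ≤ ⌈c·P⌉` over `ℝ`. [folklore] -/
theorem corner_le_ceil (c : ℚ) (P : ℤ) : (c : ℝ) * (P : ℝ) ≤ ((⌈c * (P : ℚ)⌉ : ℤ) : ℝ) := by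
  have h : c * (P : ℚ) ≤ ((⌈c * (P : ℚ)⌉ : ℤ) : ℚ) := Int.le_ceil _
  have h' : ((c * (P : ℚ) : ℚ) : ℝ) ≤ (((⌈c * (P : ℚ)⌉ : ℤ) : ℚ) : ℝ) := Rat.cast_le.2 h
  simpa [Rat.cast_mul, Rat.cast_intCast] using h'

/-- a floor corner: `⌊c·P⌋ ≤ c·P` over `ℝ`. [folklore] -/
theorem floor_le_corner (c : ℚ) (P : ℤ) : ((⌊c * (P : ℚ)⌋ : ℤ) : ℝ) ≤ (c : ℝ) * (P : ℝ) := by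
  have h : ((⌊c * (P : ℚ)⌋ : ℤ) : ℚ) ≤ c * (P : ℚ) := Int.floor_le _
  have h' : (((⌊c * (P : ℚ)⌋ : ℤ) : ℚ) : ℝ) ≤ ((c * (P : ℚ) : ℚ) : ℝ) := Rat.cast_le.2 h
  simpa [Rat.cast_mul, Rat.cast_intCast] using h'

/-- ★ `S·(x·g) ≤ cornerHi PL PH glo ghi` whenever `PL ≤ S·x ≤ PH` and `glo ≤ g ≤ ghi` ((238) `mul_le_of_corners`). [folklore] -/
theorem le_cornerHi {S PL PH : ℤ} {glo ghi : ℚ} {x g : ℝ} (hL : (PL : ℝ) ≤ S * x) (hH : S * x ≤ (PH : ℝ))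
    (hg1 : (glo : ℝ) ≤ g) (hg2 : g ≤ (ghi : ℝ)) : S * (x * g) ≤ ((cornerHi PL PH glo ghi : ℤ) : ℝ) := by
  have W := mul_le_of_corners hg1 hg2 hL hH
  have e : (S : ℝ) * (x * g) = g * (S * x) := by ring
  rw [e]
  refine W.trans ?_
  unfold cornerHi; push_cast
  exact max_le_max (max_le_max (corner_le_ceil glo PL) (corner_le_ceil glo PH))
    (max_le_max (corner_le_ceil ghi PL) (corner_le_ceil ghi PH))

/-- ★ `cornerLo PL PH glo ghi ≤ S·(x·g)` ((238) `corners_le_mul`). [folklore] -/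
theorem cornerLo_le {S PL PH : ℤ} {glo ghi : ℚ} {x g : ℝ} (hL : (PL : ℝ) ≤ S * x) (hH : S * x ≤ (PH : ℝ))
    (hg1 : (glo : ℝ) ≤ g) (hg2 : g ≤ (ghi : ℝ)) : ((cornerLo PL PH glo ghi : ℤ) : ℝ) ≤ S * (x * g) := by
  have W := corners_le_mul hg1 hg2 hL hH
  have e : (S : ℝ) * (x * g) = g * (S * x) := by ring
  rw [e]
  refine le_trans ?_ W
  unfold cornerLo; push_cast
  exact min_le_min (min_le_min (floor_le_corner glo PL) (floor_le_corner glo PH))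
    (min_le_min (floor_le_corner ghi PL) (floor_le_corner ghi PH))

end Summit.AtomisticToContinuum.Crystallization.Theorems.FrustratedLawDichotomyCellArithTaylor
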